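import Summits.AtomisticToContinuum.FouriersLaw.Theorems.OddSectorIrreversibilityOddCorrectorDecayCurrentVarianceA
import Summits.AtomisticToContinuum.FouriersLaw.Theorems.BondHeatUncertaintySubdiffusiveBondHeatKernelGibbsA

/-!
# Extensivity of the current's `L²(Gibbs)` norm, II: `‖J‖² = T ∑_m ‖c_m‖²` and the next-nearest-neighbour spread

Support file for item `stmt-AtomisticToContinuum-9139` (`OddSectorIrreversibility.OddCorrectorDecay`), negative
side (static input `M_N ≥ c (N-2) Z_N` of the bath-locality estimate).
* `pinnedChain_integral_totalCurrent_sq_eq` — summing the Gaussian integration by parts of part I over the momenta: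
  `∫ J² e^{-H/T} = T ∫ (∑_m c_m²) e^{-H/T}`.
* `pinnedChain_integral_coordDiff_mul_force` — for two distinct sites `s₀ ≠ s₁`, Gibbs integration by parts in the
  POSITION `q_{s₀}` gives `∫ (q_{s₀} - q_{s₁}) ∂_{s₀}H e^{-H/T} = T ∫ e^{-H/T}`;
* `pinnedChain_sq_mass_le_spread_mul_force` — Cauchy–Schwarz turns this into the spread bound
  `(T Z_N)² ≤ (∫ (q_{s₀} - q_{s₁})² e^{-H/T}) (∫ (∂_{s₀}H)² e^{-H/T})`. The force moment is bounded by one-site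
  moments in part III.
-/

noncomputable section

open MeasureTheory Finset
open Literature.MathematicalPhysics.KineticTheory.HeatConduction
open Summit.AtomisticToContinuum.FouriersLaw.Theorems.SubdiffusiveBondHeat

namespace Summit.AtomisticToContinuum.FouriersLaw.Theorems.ChainVariation

variable {N : ℕ}

section Pinned

variable {ω₂ lam β : ℝ} (hω : 0 < ω₂) (hl : 0 ≤ lam) (hβ : 0 ≤ β) (γ : ℝ) (N : ℕ) {T : ℝ} (hT : 0 < T)
include hω hl hβ hT

omit hω hl hβ hT in
/-- Continuity of the momentum coefficient `c_m` (a polynomial). [folklore] -/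
theorem pinnedChain_continuous_coeff (m : Fin N) :
    Continuous fun x : PhaseSpace N =>
      (∑ j : Fin N, if j.val = m.val + 1 then -(deriv (pinnedChain ω₂ lam β γ).V (x.1 j - x.1 m)) / 2 else 0) +
        ∑ i : Fin N, if m.val = i.val + 1 then -(deriv (pinnedChain ω₂ lam β γ).V (x.1 m - x.1 i)) / 2 else 0 := by
  have hVc : Continuous (deriv (pinnedChain ω₂ lam β γ).V) := by
    have : deriv (pinnedChain ω₂ lam β γ).V = fun r => r + β * r ^ 3 :=
      funext fun r => pinnedChain_deriv_V ω₂ lam β γ r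
    rw [this]; fun_prop
  refine Continuous.add (continuous_finsetSum _ fun j _ => ?_) (continuous_finsetSum _ fun i _ => ?_)
  · split_ifs
    · exact ((hVc.comp (((continuous_apply j).comp continuous_fst).sub
        ((continuous_apply m).comp continuous_fst))).neg).div_const _
    · exact continuous_const
  · split_ifs
    · exact ((hVc.comp (((continuous_apply m).comp continuous_fst).sub
        ((continuous_apply i).comp continuous_fst))).neg).div_const _
    · exact continuous_const

/-- `p_m c_m J e^{-H/T}` is integrable (`≤ C(1+H)⁴ e^{-H/T}`). [folklore] -/
theorem pinnedChain_integrable_momentum_coeff_totalCurrent (m : Fin N) :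
    Integrable fun x : PhaseSpace N => x.2 m *
      ((∑ j : Fin N, if j.val = m.val + 1 then -(deriv (pinnedChain ω₂ lam β γ).V (x.1 j - x.1 m)) / 2 else 0) +
        ∑ i : Fin N, if m.val = i.val + 1 then -(deriv (pinnedChain ω₂ lam β γ).V (x.1 m - x.1 i)) / 2 else 0) *
      (∑ i, (pinnedChain ω₂ lam β γ).bondCurrent N i x) * (pinnedChain ω₂ lam β γ).gibbsDensity N T x := by
  set P := pinnedChain ω₂ lam β γ with hP
  have hcc := pinnedChain_continuous_coeff (ω₂ := ω₂) (lam := lam) (β := β) γ N m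
  have hJc : Continuous fun x : PhaseSpace N => ∑ i, P.bondCurrent N i x :=
    continuous_finsetSum _ fun i _ => pinnedChain_continuous_bondCurrent ω₂ lam β γ N i
  have hpc : Continuous fun x : PhaseSpace N => x.2 m := (continuous_apply m).comp continuous_snd
  refine pinnedChain_integrable_mul_gibbsDensity_of_le_pow_four hω hl hβ γ N hT ((hpc.mul hcc).mul hJc)
    (C := (3 + β) * (N * (N * ((3 + β) / 2)))) fun x => ?_
  have hH0 : 0 ≤ P.hamiltonian N x := pinnedChain_hamiltonian_nonneg hω.le hl hβ γ N x
  have hcb := pinnedChain_abs_coeff_le hω hl hβ γ N x m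
  have hpb := pinnedChain_abs_momentum_le hω hl hβ γ N x m
  have hJb : |∑ i, P.bondCurrent N i x| ≤ N * (N * ((3 + β) / 2)) * (1 + P.hamiltonian N x) ^ 2 := by
    calc |∑ i, P.bondCurrent N i x| ≤ ∑ i, |P.bondCurrent N i x| := Finset.abs_sum_le_sum_abs _ _
      _ ≤ ∑ _i : Fin N, N * ((3 + β) / 2 * (1 + P.hamiltonian N x) ^ 2) :=
          Finset.sum_le_sum fun i _ => pinnedChain_abs_bondCurrent_le hω.le hl hβ γ N i x
      _ = N * (N * ((3 + β) / 2)) * (1 + P.hamiltonian N x) ^ 2 := by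
          simp [Finset.sum_const, Finset.card_univ, Fintype.card_fin]; ring
  rw [abs_mul, abs_mul]
  have e : (3 + β) * (N * (N * ((3 + β) / 2))) * (1 + P.hamiltonian N x) ^ 4 =
      (1 + P.hamiltonian N x) * ((3 + β) * (1 + P.hamiltonian N x)) *
        (N * (N * ((3 + β) / 2)) * (1 + P.hamiltonian N x) ^ 2) := by ring
  rw [e]
  exact mul_le_mul (mul_le_mul hpb hcb (abs_nonneg _) (by positivity)) hJb (abs_nonneg _) (by positivity)

/-- `c_m² e^{-H/T}` is integrable. [folklore] -/
theorem pinnedChain_integrable_coeff_sq (m : Fin N) :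
    Integrable fun x : PhaseSpace N =>
      ((∑ j : Fin N, if j.val = m.val + 1 then -(deriv (pinnedChain ω₂ lam β γ).V (x.1 j - x.1 m)) / 2 else 0) +
        ∑ i : Fin N, if m.val = i.val + 1 then -(deriv (pinnedChain ω₂ lam β γ).V (x.1 m - x.1 i)) / 2 else 0) ^ 2 *
      (pinnedChain ω₂ lam β γ).gibbsDensity N T x := by
  set P := pinnedChain ω₂ lam β γ with hP
  have hcc := pinnedChain_continuous_coeff (ω₂ := ω₂) (lam := lam) (β := β) γ N m
  refine pinnedChain_integrable_mul_gibbsDensity_of_le_pow_four hω hl hβ γ N hT (hcc.pow 2)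
    (C := (3 + β) ^ 2) fun x => ?_
  have hH0 : 0 ≤ P.hamiltonian N x := pinnedChain_hamiltonian_nonneg hω.le hl hβ γ N x
  have hcb := pinnedChain_abs_coeff_le hω hl hβ γ N x m
  rw [abs_pow, show (4:ℕ) = 2 * 2 from rfl, pow_mul]
  have h1 : |(∑ j : Fin N, if j.val = m.val + 1 then -(deriv P.V (x.1 j - x.1 m)) / 2 else 0) +
        ∑ i : Fin N, if m.val = i.val + 1 then -(deriv P.V (x.1 m - x.1 i)) / 2 else 0| ^ 2 ≤
      ((3 + β) * (1 + P.hamiltonian N x)) ^ 2 := pow_le_pow_left₀ (abs_nonneg _) hcb 2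
  have h2 : (1 + P.hamiltonian N x) ^ 2 ≤ ((1 + P.hamiltonian N x) ^ 2) ^ 2 := by
    have : 1 ≤ (1 + P.hamiltonian N x) ^ 2 := by nlinarith
    nlinarith
  calc _ ≤ ((3 + β) * (1 + P.hamiltonian N x)) ^ 2 := h1
    _ = (3 + β) ^ 2 * (1 + P.hamiltonian N x) ^ 2 := by ring
    _ ≤ (3 + β) ^ 2 * ((1 + P.hamiltonian N x) ^ 2) ^ 2 := mul_le_mul_of_nonneg_left h2 (by positivity)

/-- **`∫ J² e^{-H/T} = T ∫ (∑_m c_m²) e^{-H/T}`** (Gaussian integration by parts in every momentum, summed).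
[folklore] -/
theorem pinnedChain_integral_totalCurrent_sq_eq :
    ∫ x, (∑ i, (pinnedChain ω₂ lam β γ).bondCurrent N i x) ^ 2 * (pinnedChain ω₂ lam β γ).gibbsDensity N T x =
      T * ∫ x, (∑ m : Fin N,
        ((∑ j : Fin N, if j.val = m.val + 1 then -(deriv (pinnedChain ω₂ lam β γ).V (x.1 j - x.1 m)) / 2 else 0) +
          ∑ i : Fin N, if m.val = i.val + 1 then -(deriv (pinnedChain ω₂ lam β γ).V (x.1 m - x.1 i)) / 2 else 0) ^ 2) *
        (pinnedChain ω₂ lam β γ).gibbsDensity N T x := by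
  set P := pinnedChain ω₂ lam β γ with hP
  set c : Fin N → PhaseSpace N → ℝ := fun m x =>
    (∑ j : Fin N, if j.val = m.val + 1 then -(deriv P.V (x.1 j - x.1 m)) / 2 else 0) +
      ∑ i : Fin N, if m.val = i.val + 1 then -(deriv P.V (x.1 m - x.1 i)) / 2 else 0 with hc
  have hrep : ∀ x, ∑ i, P.bondCurrent N i x = ∑ m, x.2 m * c m x := fun x =>
    totalCurrent_eq_sum_momentum_mul_coeff P x
  have hI : ∀ m, Integrable fun x => x.2 m * c m x * (∑ i, P.bondCurrent N i x) * P.gibbsDensity N T x :=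
    fun m => pinnedChain_integrable_momentum_coeff_totalCurrent hω hl hβ γ N hT m
  have hI2 : ∀ m, Integrable fun x => c m x ^ 2 * P.gibbsDensity N T x :=
    fun m => pinnedChain_integrable_coeff_sq hω hl hβ γ N hT m
  have hm : ∀ m, ∫ x, x.2 m * c m x * (∑ i, P.bondCurrent N i x) * P.gibbsDensity N T x =
      T * ∫ x, c m x ^ 2 * P.gibbsDensity N T x :=
    fun m => pinnedChain_integral_momentum_coeff_totalCurrent hω hl hβ γ N hT m
  calc ∫ x, (∑ i, P.bondCurrent N i x) ^ 2 * P.gibbsDensity N T x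
      = ∫ x, ∑ m, x.2 m * c m x * (∑ i, P.bondCurrent N i x) * P.gibbsDensity N T x := by
        refine integral_congr_ae (Filter.Eventually.of_forall fun x => ?_)
        show (∑ i, P.bondCurrent N i x) ^ 2 * P.gibbsDensity N T x = _
        rw [sq, hrep x, Finset.sum_mul, Finset.sum_mul]
        refine Finset.sum_congr rfl fun m _ => ?_
        rw [← hrep x]
    _ = ∑ m, ∫ x, x.2 m * c m x * (∑ i, P.bondCurrent N i x) * P.gibbsDensity N T x :=
        integral_finsetSum _ fun m _ => hI m
    _ = ∑ m, T * ∫ x, c m x ^ 2 * P.gibbsDensity N T x := Finset.sum_congr rfl fun m _ => hm m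
    _ = T * ∫ x, (∑ m, c m x ^ 2) * P.gibbsDensity N T x := by
        rw [← Finset.mul_sum, ← integral_finsetSum _ fun m _ => hI2 m]
        congr 1
        refine integral_congr_ae (Filter.Eventually.of_forall fun x => ?_)
        show ∑ m, c m x ^ 2 * P.gibbsDensity N T x = (∑ m, c m x ^ 2) * P.gibbsDensity N T x
        rw [Finset.sum_mul]

end Pinned

variable {N : ℕ}

section Pinned

variable {ω₂ lam β : ℝ} (hω : 0 < ω₂) (hl : 0 ≤ lam) (hβ : 0 ≤ β) (γ : ℝ) (N : ℕ) {T : ℝ} (hT : 0 < T)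
include hω hl hβ hT

omit hT in
/-- `|q_k| ≤ (1 + 1/ω₂)(1 + H)` (from `ω₂ q_k²/2 ≤ H`). [folklore] -/
theorem pinnedChain_abs_coord_le (x : PhaseSpace N) (k : Fin N) :
    |x.1 k| ≤ (1 + ω₂⁻¹) * (1 + (pinnedChain ω₂ lam β γ).hamiltonian N x) := by
  have h := pinnedChain_harmonic_le_hamiltonian (ω₂ := ω₂) hl hβ γ N x
  have h1 : ω₂ * x.1 k ^ 2 / 2 ≤ ∑ i, ω₂ * x.1 i ^ 2 / 2 :=
    Finset.single_le_sum (f := fun i => ω₂ * x.1 i ^ 2 / 2) (fun i _ => by positivity) (Finset.mem_univ k)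
  have h2 : 0 ≤ ∑ i, x.2 i ^ 2 / 2 := Finset.sum_nonneg fun i _ => by positivity
  have hH : ω₂ * x.1 k ^ 2 / 2 ≤ (pinnedChain ω₂ lam β γ).hamiltonian N x := by linarith
  have hH0 : 0 ≤ (pinnedChain ω₂ lam β γ).hamiltonian N x := pinnedChain_hamiltonian_nonneg hω.le hl hβ γ N x
  -- `|q| ≤ (1 + q²)/2 ≤ … `
  have hq2 : x.1 k ^ 2 ≤ 2 * ω₂⁻¹ * (pinnedChain ω₂ lam β γ).hamiltonian N x := by
    have := mul_le_mul_of_nonneg_left hH (show 0 ≤ 2 * ω₂⁻¹ by positivity)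
    calc x.1 k ^ 2 = 2 * ω₂⁻¹ * (ω₂ * x.1 k ^ 2 / 2) := by field_simp
      _ ≤ 2 * ω₂⁻¹ * (pinnedChain ω₂ lam β γ).hamiltonian N x := this
  have habs : |x.1 k| ≤ (1 + x.1 k ^ 2) / 2 := by
    nlinarith [sq_nonneg (|x.1 k| - 1), sq_abs (x.1 k), abs_nonneg (x.1 k)]
  have hω' : 0 ≤ ω₂⁻¹ := by positivity
  nlinarith

/-- **Gibbs integration by parts in a position**: for distinct sites `s₀ ≠ s₁`,
`∫ (q_{s₀} - q_{s₁}) ∂_{s₀}H e^{-H/T} dx = T ∫ e^{-H/T} dx` (`∂_{q_{s₀}} e^{-H/T} = -(∂_{s₀}H/T) e^{-H/T}`,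
`∂_{q_{s₀}}(q_{s₀} - q_{s₁}) = 1`). [folklore] -/
theorem pinnedChain_integral_coordDiff_mul_force (s₀ s₁ : Fin N) (hs : s₀ ≠ s₁) :
    ∫ x, (x.1 s₀ - x.1 s₁) * (pinnedChain ω₂ lam β γ).dPotential N s₀ x.1 *
        (pinnedChain ω₂ lam β γ).gibbsDensity N T x =
      T * ∫ x, (pinnedChain ω₂ lam β γ).gibbsDensity N T x := by
  set P := pinnedChain ω₂ lam β γ with hP
  set ρ : PhaseSpace N → ℝ := P.gibbsDensity N T with hρ
  set v : PhaseSpace N := ((Pi.single s₀ 1, 0) : PhaseSpace N) with hv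
  have hUd : Differentiable ℝ P.U := (pinnedChain_contDiff_U ω₂ lam β γ (n := 1)).differentiable one_ne_zero
  have hVd : Differentiable ℝ P.V := (pinnedChain_contDiff_V ω₂ lam β γ (n := 1)).differentiable one_ne_zero
  have hHd : Differentiable ℝ (P.hamiltonian N) :=
    (pinnedChain_contDiff_hamiltonian ω₂ lam β γ N (n := 1)).differentiable one_ne_zero
  have hdPc : Continuous fun x : PhaseSpace N => P.dPotential N s₀ x.1 :=
    (P.contDiff_dPotential (pinnedChain_contDiff_U ω₂ lam β γ) (pinnedChain_contDiff_V ω₂ lam β γ) N s₀).continuous.comp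
      continuous_fst
  have hFc : Continuous fun x : PhaseSpace N => x.1 s₀ - x.1 s₁ :=
    ((continuous_apply s₀).comp continuous_fst).sub ((continuous_apply s₁).comp continuous_fst)
  -- line derivatives
  have hFd : ∀ x, HasLineDerivAt ℝ (fun z : PhaseSpace N => z.1 s₀ - z.1 s₁) 1 x v := by
    intro x
    unfold HasLineDerivAt
    have h : (fun t : ℝ => (x + t • v).1 s₀ - (x + t • v).1 s₁) = fun t => (x.1 s₀ - x.1 s₁) + t := by
      funext t
      simp [hv, Pi.single_eq_of_ne (Ne.symm hs)]
      ring
    show HasDerivAt (fun t : ℝ => (x + t • v).1 s₀ - (x + t • v).1 s₁) 1 0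
    rw [h]
    exact (hasDerivAt_id (0:ℝ)).const_add _
  have hgd : ∀ x, HasLineDerivAt ℝ ρ (-(P.dPotential N s₀ x.1 / T) * ρ x) x v := by
    intro x
    have h := P.hasLineDerivAt_gibbsDensity (T := T) (P.hasLineDerivAt_hamiltonian_unitQ hHd x s₀)
    rw [P.partialQ_hamiltonian_eq_dPotential hUd hVd] at h
    exact h
  -- integrability
  have hH0 : ∀ x, 0 ≤ P.hamiltonian N x := fun x => pinnedChain_hamiltonian_nonneg hω.le hl hβ γ N x
  obtain ⟨A, hA0, hA⟩ := (pinnedChain_isConfining hω hl hβ le_rfl : (pinnedChain ω₂ lam β 0).IsConfining).exists_abs_deriv_U_le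
  obtain ⟨B, hB0, hB⟩ := (pinnedChain_isConfining hω hl hβ le_rfl : (pinnedChain ω₂ lam β 0).IsConfining).exists_abs_deriv_V_le
  have hdPb : ∀ x : PhaseSpace N, |P.dPotential N s₀ x.1| ≤ (A + N ^ 2 * B) * (1 + P.hamiltonian N x) := by
    intro x
    have h := (pinnedChain ω₂ lam β 0).abs_dPotential_le hA0 hB0 hA hB
      (fun q => by show 0 ≤ ω₂ * q ^ 2 / 2 + lam * q ^ 4 / 4; positivity)
      (fun r => by show 0 ≤ r ^ 2 / 2 + β * r ^ 4 / 4; positivity) N x s₀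
    exact h
  have hqb : ∀ x : PhaseSpace N, |x.1 s₀ - x.1 s₁| ≤ 2 * (1 + ω₂⁻¹) * (1 + P.hamiltonian N x) := by
    intro x
    calc |x.1 s₀ - x.1 s₁| ≤ |x.1 s₀| + |x.1 s₁| := abs_sub _ _
      _ ≤ (1 + ω₂⁻¹) * (1 + P.hamiltonian N x) + (1 + ω₂⁻¹) * (1 + P.hamiltonian N x) :=
          add_le_add (pinnedChain_abs_coord_le hω hl hβ γ N x s₀) (pinnedChain_abs_coord_le hω hl hβ γ N x s₁)
      _ = 2 * (1 + ω₂⁻¹) * (1 + P.hamiltonian N x) := by ring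
  have hI1 : Integrable fun x => (1:ℝ) * ρ x := by
    have := pinnedChain_integrable_gibbsDensity hω hl hβ γ N hT
    simpa [hρ] using this
  have hI2 : Integrable fun x => (x.1 s₀ - x.1 s₁) * (-(P.dPotential N s₀ x.1 / T) * ρ x) := by
    have hgc : Continuous fun x : PhaseSpace N => (x.1 s₀ - x.1 s₁) * (-(P.dPotential N s₀ x.1 / T)) :=
      hFc.mul (hdPc.div_const T).neg
    have h := pinnedChain_integrable_mul_gibbsDensity_of_le hω hl hβ γ N hT (g := fun x =>
      (x.1 s₀ - x.1 s₁) * (-(P.dPotential N s₀ x.1 / T))) hgc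
      (C := 2 * (1 + ω₂⁻¹) * (A + N ^ 2 * B) * T⁻¹) fun x => by
        rw [abs_mul, abs_neg, abs_div, abs_of_pos hT]
        have e : 2 * (1 + ω₂⁻¹) * (A + N ^ 2 * B) * T⁻¹ * (1 + P.hamiltonian N x) ^ 2 =
            (2 * (1 + ω₂⁻¹) * (1 + P.hamiltonian N x)) * (((A + N ^ 2 * B) * (1 + P.hamiltonian N x)) / T) := by
          rw [div_eq_mul_inv]; ring
        rw [e]
        have hH0x := hH0 x
        exact mul_le_mul (hqb x) (div_le_div_of_nonneg_right (hdPb x) hT.le) (by positivity) (by positivity)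
    refine h.congr (Filter.Eventually.of_forall fun x => ?_)
    show (x.1 s₀ - x.1 s₁) * (-(P.dPotential N s₀ x.1 / T)) * P.gibbsDensity N T x = _
    simp only [hρ]; ring
  have hI3 : Integrable fun x => (x.1 s₀ - x.1 s₁) * ρ x := by
    refine pinnedChain_integrable_mul_gibbsDensity_of_le hω hl hβ γ N hT hFc (C := 2 * (1 + ω₂⁻¹)) fun x => ?_
    have hH0x := hH0 x
    calc |x.1 s₀ - x.1 s₁| ≤ 2 * (1 + ω₂⁻¹) * (1 + P.hamiltonian N x) := hqb x
      _ ≤ 2 * (1 + ω₂⁻¹) * (1 + P.hamiltonian N x) ^ 2 := by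
          refine mul_le_mul_of_nonneg_left ?_ (by positivity)
          nlinarith
  have hibp := integral_mul_eq_neg_of_hasLineDerivAt_of_integrable hI1 hI2 hI3 hFd hgd
  -- unwind: `∫ F (-(∂H/T) ρ) = -∫ ρ`
  have e1 : ∫ x, (x.1 s₀ - x.1 s₁) * (-(P.dPotential N s₀ x.1 / T) * ρ x) =
      -T⁻¹ * ∫ x, (x.1 s₀ - x.1 s₁) * P.dPotential N s₀ x.1 * ρ x := by
    rw [← integral_const_mul]
    refine integral_congr_ae (Filter.Eventually.of_forall fun x => ?_)
    show (x.1 s₀ - x.1 s₁) * (-(P.dPotential N s₀ x.1 / T) * ρ x) = -T⁻¹ * ((x.1 s₀ - x.1 s₁) * P.dPotential N s₀ x.1 * ρ x)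
    rw [div_eq_mul_inv]; ring
  have e2 : ∫ x, (1:ℝ) * ρ x = ∫ x, ρ x := integral_congr_ae (Filter.Eventually.of_forall fun x => one_mul _)
  rw [e1, e2] at hibp
  have h3 : T⁻¹ * ∫ x, (x.1 s₀ - x.1 s₁) * P.dPotential N s₀ x.1 * ρ x = ∫ x, ρ x := by linarith
  calc ∫ x, (x.1 s₀ - x.1 s₁) * P.dPotential N s₀ x.1 * ρ x
      = T * (T⁻¹ * ∫ x, (x.1 s₀ - x.1 s₁) * P.dPotential N s₀ x.1 * ρ x) := by
        rw [← mul_assoc, mul_inv_cancel₀ hT.ne', one_mul]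
    _ = T * ∫ x, ρ x := by rw [h3]

/-- **Spread bound from the position integration by parts and Cauchy–Schwarz**: for distinct sites `s₀ ≠ s₁`,
`(T ∫ e^{-H/T})² ≤ (∫ (q_{s₀} - q_{s₁})² e^{-H/T}) (∫ (∂_{s₀}H)² e^{-H/T})`. [folklore] -/
theorem pinnedChain_sq_mass_le_spread_mul_force (s₀ s₁ : Fin N) (hs : s₀ ≠ s₁) :
    (T * ∫ x, (pinnedChain ω₂ lam β γ).gibbsDensity N T x) ^ 2 ≤
      (∫ x, (x.1 s₀ - x.1 s₁) ^ 2 * (pinnedChain ω₂ lam β γ).gibbsDensity N T x) *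
        ∫ x, ((pinnedChain ω₂ lam β γ).dPotential N s₀ x.1) ^ 2 * (pinnedChain ω₂ lam β γ).gibbsDensity N T x := by
  set P := pinnedChain ω₂ lam β γ with hP
  set ρ : PhaseSpace N → ℝ := P.gibbsDensity N T with hρ
  set d : PhaseSpace N → ℝ := fun x => x.1 s₀ - x.1 s₁ with hd
  set G : PhaseSpace N → ℝ := fun x => P.dPotential N s₀ x.1 with hG
  have hρ0 : ∀ x, 0 < ρ x := fun x => P.gibbsDensity_pos N T x
  have hρc : Continuous ρ := pinnedChain_continuous_gibbsDensity ω₂ lam β γ N T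
  have hdc : Continuous d := ((continuous_apply s₀).comp continuous_fst).sub ((continuous_apply s₁).comp continuous_fst)
  have hGc : Continuous G :=
    (P.contDiff_dPotential (pinnedChain_contDiff_U ω₂ lam β γ) (pinnedChain_contDiff_V ω₂ lam β γ) N s₀).continuous.comp
      continuous_fst
  have hH0 : ∀ x, 0 ≤ P.hamiltonian N x := fun x => pinnedChain_hamiltonian_nonneg hω.le hl hβ γ N x
  -- polynomial bounds and square integrability
  obtain ⟨A, hA0, hA⟩ := (pinnedChain_isConfining hω hl hβ le_rfl : (pinnedChain ω₂ lam β 0).IsConfining).exists_abs_deriv_U_le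
  obtain ⟨B, hB0, hB⟩ := (pinnedChain_isConfining hω hl hβ le_rfl : (pinnedChain ω₂ lam β 0).IsConfining).exists_abs_deriv_V_le
  have hGb : ∀ x : PhaseSpace N, |G x| ≤ (A + N ^ 2 * B) * (1 + P.hamiltonian N x) := fun x =>
    (pinnedChain ω₂ lam β 0).abs_dPotential_le hA0 hB0 hA hB
      (fun q => by show 0 ≤ ω₂ * q ^ 2 / 2 + lam * q ^ 4 / 4; positivity)
      (fun r => by show 0 ≤ r ^ 2 / 2 + β * r ^ 4 / 4; positivity) N x s₀
  have hdb : ∀ x : PhaseSpace N, |d x| ≤ 2 * (1 + ω₂⁻¹) * (1 + P.hamiltonian N x) := by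
    intro x
    calc |d x| ≤ |x.1 s₀| + |x.1 s₁| := abs_sub _ _
      _ ≤ (1 + ω₂⁻¹) * (1 + P.hamiltonian N x) + (1 + ω₂⁻¹) * (1 + P.hamiltonian N x) :=
          add_le_add (pinnedChain_abs_coord_le hω hl hβ γ N x s₀) (pinnedChain_abs_coord_le hω hl hβ γ N x s₁)
      _ = 2 * (1 + ω₂⁻¹) * (1 + P.hamiltonian N x) := by ring
  have hId : Integrable fun x => d x ^ 2 * ρ x := by
    refine pinnedChain_integrable_mul_gibbsDensity_of_le hω hl hβ γ N hT (hdc.pow 2) (C := (2 * (1 + ω₂⁻¹)) ^ 2)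
      fun x => ?_
    rw [abs_pow, ← mul_pow]
    exact pow_le_pow_left₀ (abs_nonneg _) (hdb x) 2
  have hIG : Integrable fun x => G x ^ 2 * ρ x := by
    refine pinnedChain_integrable_mul_gibbsDensity_of_le hω hl hβ γ N hT (hGc.pow 2) (C := (A + N ^ 2 * B) ^ 2)
      fun x => ?_
    rw [abs_pow, ← mul_pow]
    exact pow_le_pow_left₀ (abs_nonneg _) (hGb x) 2
  have hIdG : Integrable fun x => |d x| * |G x| * ρ x := by
    refine pinnedChain_integrable_mul_gibbsDensity_of_le hω hl hβ γ N hT (hdc.abs.mul hGc.abs)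
      (C := 2 * (1 + ω₂⁻¹) * (A + N ^ 2 * B)) fun x => ?_
    rw [abs_mul, abs_abs, abs_abs]
    have hH0x := hH0 x
    calc |d x| * |G x| ≤ (2 * (1 + ω₂⁻¹) * (1 + P.hamiltonian N x)) * ((A + N ^ 2 * B) * (1 + P.hamiltonian N x)) :=
          mul_le_mul (hdb x) (hGb x) (abs_nonneg _) (by positivity)
      _ = 2 * (1 + ω₂⁻¹) * (A + N ^ 2 * B) * (1 + P.hamiltonian N x) ^ 2 := by ring
  -- the mass identity and `∫ dGρ ≤ ∫ |d||G|ρ`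
  have hmass := pinnedChain_integral_coordDiff_mul_force hω hl hβ γ N hT s₀ s₁ hs
  have h1 : T * ∫ x, ρ x ≤ ∫ x, |d x| * |G x| * ρ x := by
    rw [← hmass]
    have hI0 : Integrable fun x => (x.1 s₀ - x.1 s₁) * P.dPotential N s₀ x.1 * ρ x := by
      refine hIdG.mono' ((hdc.mul hGc).mul hρc).aestronglyMeasurable (Filter.Eventually.of_forall fun x => ?_)
      rw [Real.norm_eq_abs, abs_mul, abs_mul, abs_of_pos (hρ0 x)]
    refine integral_mono hI0 hIdG fun x => ?_
    show (x.1 s₀ - x.1 s₁) * P.dPotential N s₀ x.1 * ρ x ≤ |d x| * |G x| * ρ x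
    have h0 := hρ0 x
    calc (x.1 s₀ - x.1 s₁) * P.dPotential N s₀ x.1 * ρ x = d x * G x * ρ x := rfl
      _ ≤ |d x * G x| * ρ x := mul_le_mul_of_nonneg_right (le_abs_self _) h0.le
      _ = |d x| * |G x| * ρ x := by rw [abs_mul]
  -- Hölder (`p = q = 2`) with `f = |d|√ρ`, `g = |G|√ρ`
  set f : PhaseSpace N → ℝ := fun x => |d x| * Real.sqrt (ρ x) with hf
  set g : PhaseSpace N → ℝ := fun x => |G x| * Real.sqrt (ρ x) with hg
  have hfg : ∀ x, f x * g x = |d x| * |G x| * ρ x := fun x => by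
    have e := Real.mul_self_sqrt (hρ0 x).le
    calc f x * g x = |d x| * |G x| * (Real.sqrt (ρ x) * Real.sqrt (ρ x)) := by simp only [hf, hg]; ring
      _ = |d x| * |G x| * ρ x := by rw [e]
  have hf2 : ∀ x, f x ^ 2 = d x ^ 2 * ρ x := fun x => by
    simp only [hf]; rw [mul_pow, sq_abs, Real.sq_sqrt (hρ0 x).le]
  have hg2 : ∀ x, g x ^ 2 = G x ^ 2 * ρ x := fun x => by
    simp only [hg]; rw [mul_pow, sq_abs, Real.sq_sqrt (hρ0 x).le]
  have hfc : Continuous f := hdc.abs.mul (Real.continuous_sqrt.comp hρc)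
  have hgc' : Continuous g := hGc.abs.mul (Real.continuous_sqrt.comp hρc)
  have hfm : MemLp f (ENNReal.ofReal 2) volume := by
    rw [ENNReal.ofReal_ofNat, memLp_two_iff_integrable_sq hfc.aestronglyMeasurable]
    simp_rw [hf2]; exact hId
  have hgm : MemLp g (ENNReal.ofReal 2) volume := by
    rw [ENNReal.ofReal_ofNat, memLp_two_iff_integrable_sq hgc'.aestronglyMeasurable]
    simp_rw [hg2]; exact hIG
  have hholder := integral_mul_le_Lp_mul_Lq_of_nonneg Real.HolderConjugate.two_two
    (Filter.Eventually.of_forall fun x => by simp only [hf, Pi.zero_apply]; positivity)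
    (Filter.Eventually.of_forall fun x => by simp only [hg, Pi.zero_apply]; positivity) hfm hgm
  simp only [Real.rpow_two, hf2, hg2, hfg] at hholder
  have hX : 0 ≤ ∫ x, d x ^ 2 * ρ x := integral_nonneg fun x => mul_nonneg (sq_nonneg _) (hρ0 x).le
  have hY : 0 ≤ ∫ x, G x ^ 2 * ρ x := integral_nonneg fun x => mul_nonneg (sq_nonneg _) (hρ0 x).le
  have h2 : T * ∫ x, ρ x ≤ Real.sqrt (∫ x, d x ^ 2 * ρ x) * Real.sqrt (∫ x, G x ^ 2 * ρ x) := by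
    rw [Real.sqrt_eq_rpow, Real.sqrt_eq_rpow]
    exact h1.trans hholder
  have hTZ : 0 ≤ T * ∫ x, ρ x := mul_nonneg hT.le (integral_nonneg fun x => (hρ0 x).le)
  calc (T * ∫ x, ρ x) ^ 2
      ≤ (Real.sqrt (∫ x, d x ^ 2 * ρ x) * Real.sqrt (∫ x, G x ^ 2 * ρ x)) ^ 2 := pow_le_pow_left₀ hTZ h2 2
    _ = (∫ x, d x ^ 2 * ρ x) * ∫ x, G x ^ 2 * ρ x := by
        rw [mul_pow, Real.sq_sqrt hX, Real.sq_sqrt hY]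

end Pinned

end Summit.AtomisticToContinuum.FouriersLaw.Theorems.ChainVariation

end
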